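import Literature.MathematicalPhysics.KineticTheory.HardSphereEuler
import HarnessLib

/-!
# Velocity-blind placement statistics and the local-Maxwellian defect of the `r`-pool (hard spheres on `𝕋³` at fixed reduced density)

Topic `Literature/MathematicalPhysics/KineticTheory`. Tree home for the vocabulary of the crux line `Sketch` (docking A, idea
`velocity-blind-placement`) on `InformationPercolationEngine.PercolationClosesChaos` (stmt-AtomisticToContinuum-14915; lead
`prover-line-stmt-AtomisticToContinuum-14915-0`, skeleton `Summits/AtomisticToContinuum/HydrodynamicLimit/Cruxes/PercolationClosesChaos/Lines/Sketch.lean`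
with the three registered stubs `stub_velocityBlindPlacement`, `stub_localMaxwellian`, `stub_subMeanFreeTimeWindow`). The BODIES
are byte-identical with §0–§2 of that skeleton so that the registered stubs can be stated from `Theorems/` files over importable
vocabulary; everything lives in the grouping namespace `Literature.MathematicalPhysics.KineticTheory.VelocityBlindPlacement`
(open it). Pure definitions — explicit finite sums and integrals over the library's hard-sphere prelude (`HardSphereFlow`,
`Config`, `Torus.geometry/euclidDist`, `hsDiameter`, `localGibbsLaw`'s phase space, `localMaxwellian`).

1. Frame: `Flow σ N` (flows of `N + 1` spheres of diameter `hsDiameter σ N` on `𝕋³`), `Phase N`, the mean free path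
   `meanFreePath σ N = (π (N+1) ε_N²)⁻¹` (`ℓ_N/ε_N = 1/(πσ³)` is `N`-independent), the spatial bump `bump r` (= the `bx` of the
   route target `ContactChaos`, stmt-AtomisticToContinuum-13477).
2. Placement statistics: the anchored `(k+1)`-point CLOSE statistic `closeStat k g F σ r N z x₀` at mutual scale `ℓ_N`
   (geometry test `g` on the `k` rescaled minimal-image separations from the anchor, label test `F` on the `k+1` velocities,
   injective labellings `Fin (k+1) ↪ Fin (N+1)`), the `(k+1)`-fold product ALL statistic `allStat k F r N z x₀` of the
   `r`-mollified empirical measure, and the cross-ratio defect `vbpDefect` = `∫∫ χ (Close_{g,F}·All_1 − Close_{g,1}·All_F)`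
   along a flow, time–space integrated against a localiser `χ` — "the velocity labels of an `ℓ`-close tuple are independent of
   its geometry and distributed as independent draws from the `r`-pool", in the cross-ratio format of `ContactChaos`.
3. The `r`-pool: `poolMass`, `poolMomentum`, `poolEnergy`, `poolVelocity`, `poolTemperature`, `poolTest F`, and the
   local-Maxwellian defect `maxwellDefect` = `∫∫ χ (pool[F] − ρ ∫ F M_{1,u,θ})` with `(ρ, u, θ)` the pool's own moments.

## References (design sources; every declaration here is a construction, tagged `[folklore]`)

* C. Cercignani, R. Illner, M. Pulvirenti, *The Mathematical Theory of Dilute Gases* (1994), §2.3 (molecular chaos as a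
  statement about pre-collisional pairs), §4.4 p. 86 (the short-time window), App. 4.A (collision cylinder). [CIP1994]
* H. Spohn, *Large Scale Dynamics of Interacting Particles* (1991), Part I Ch. 3 (local equilibrium / local Maxwellians of the
  empirical fields at fixed reduced density). [Spohn1991]
* O. E. Lanford, *Time evolution of large classical systems* (1975) (propagation of chaos as factorisation of correlation
  functions off the collision set). [Lanford1975]

## Not here

No statement is made: the two snapshot properties of the line (velocity-blind placement in probability; local Maxwellianity of
the pool in probability), the transfer to `ContactChaos` and the composition are problem-side (`Summits/…/Cruxes/…/Lines/Sketch.lean`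
and the `Theorems/` files that land its stubs).
-/

noncomputable section

open MeasureTheory Set
open scoped ENNReal BigOperators
open Literature.Analysis.FluidPDE

namespace Literature.MathematicalPhysics.KineticTheory

namespace VelocityBlindPlacement

/-! ## §0 Frame -/

/-- The hard-sphere flows of the crux: `N + 1` spheres of diameter `ε_N = σ (N+1)^{-1/3}` on `𝕋³`. [folklore] -/
abbrev Flow (σ : ℝ) (N : ℕ) : Type :=
  HardSphereFlow (Torus.geometry (Fin 3)) (hsDiameter σ N) (N + 1)

/-- Phase space of `N + 1` spheres on `𝕋³`. [folklore] -/
abbrev Phase (N : ℕ) : Type := Config (N + 1) (Fin 3) T3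

/-- The mean free path `ℓ_N = (π (N+1) ε_N²)⁻¹` (total cross-section `π ε²` in `d = 3`; `ℓ_N / ε_N = 1/(π σ³)` is
`N`-independent). [folklore] -/
def meanFreePath (σ : ℝ) (N : ℕ) : ℝ :=
  (Real.pi * ((N : ℝ) + 1) * hsDiameter σ N ^ 2)⁻¹

/-- The target's spatial bump `b_r(x, y) = 3/(π r³) · (1 − dist(x, y)/r)₊` (literally `ContactChaos`'s `bx`). [folklore] -/
def bump (r : ℝ) (x y : T3) : ℝ :=
  3 / (Real.pi * r ^ 3) * max (1 - Torus.euclidDist x y / r) 0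

/-! ## §1 The placement statistics -/

/-- CLOSE statistic: `((N+1) · ((N+1) ℓ³)^k)⁻¹ Σ_{f : Fin (k+1) ↪ Fin (N+1)} b_r(x_{f 0}, x₀) · g((ℓ⁻¹ (x_{f (m+1)} − x_{f 0}))_m) · F((v_{f m})_m)`
— the anchored `(k+1)`-point statistic of particles at mutual scale `ℓ_N` around the anchor `f 0`, geometry test `g` on the
`k` rescaled minimal-image separation vectors, label test `F` on the `k+1` velocities. [folklore] -/
def closeStat (k : ℕ) (g : (Fin k → V3) → ℝ) (F : (Fin (k + 1) → V3) → ℝ) (σ r : ℝ) (N : ℕ)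
    (z : Phase N) (x₀ : T3) : ℝ :=
  (((N : ℝ) + 1) * (((N : ℝ) + 1) * meanFreePath σ N ^ 3) ^ k)⁻¹ *
    ∑ f : Fin (k + 1) ↪ Fin (N + 1),
      bump r (z (f 0)).1 x₀ *
        g (fun m => (meanFreePath σ N)⁻¹ • (Torus.geometry (Fin 3)).sepVec (z (f m.succ)).1 (z (f 0)).1) *
        F (fun m => (z (f m)).2)

/-- ALL statistic: `((N+1)^{k+1})⁻¹ Σ_{f : Fin (k+1) → Fin (N+1)} (Π_m b_r(x_{f m}, x₀)) · F((v_{f m})_m)` — the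
`(k+1)`-fold product of the `r`-mollified empirical measure tested against `F` (all maps, non-injective ones included: their
weight is `O(k²/N)`). [folklore] -/
def allStat (k : ℕ) (F : (Fin (k + 1) → V3) → ℝ) (r : ℝ) (N : ℕ) (z : Phase N) (x₀ : T3) : ℝ :=
  (((N : ℝ) + 1) ^ (k + 1))⁻¹ *
    ∑ f : Fin (k + 1) → Fin (N + 1), (∏ m, bump r (z (f m)).1 x₀) * F (fun m => (z (f m)).2)

/-- The VBP cross-ratio defect, time–space integrated against the localiser `χ`:
`∫_{[0,τ]} ∫_{x₀} χ(s, x₀) · (Close_{g,F} · All_1 − Close_{g,1} · All_F)(Φ_s z, x₀)`. [folklore] -/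
def vbpDefect (k : ℕ) (g : (Fin k → V3) → ℝ) (F : (Fin (k + 1) → V3) → ℝ) (σ τ r : ℝ) (N : ℕ)
    (Φ : Flow σ N) (χ : ℝ × T3 → ℝ) (z : Phase N) : ℝ :=
  ∫ s in Icc (0 : ℝ) τ, ∫ x₀ : T3, χ (s, x₀) *
    (closeStat k g F σ r N (Φ.flow s z) x₀ * allStat k (fun _ => 1) r N (Φ.flow s z) x₀ -
      closeStat k g (fun _ => 1) σ r N (Φ.flow s z) x₀ * allStat k F r N (Φ.flow s z) x₀)

/-! ## §2 The local pool and its Maxwellian -/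

/-- Local mass of the `r`-pool at `x₀`: `(N+1)⁻¹ Σ_i b_r(x_i, x₀)` (= the target's `ρm`). [folklore] -/
def poolMass (r : ℝ) (N : ℕ) (z : Phase N) (x₀ : T3) : ℝ :=
  (((N : ℝ) + 1))⁻¹ * ∑ i : Fin (N + 1), bump r (z i).1 x₀

/-- Local momentum of the `r`-pool at `x₀`: `(N+1)⁻¹ Σ_i b_r(x_i, x₀) v_i`. [folklore] -/
def poolMomentum (r : ℝ) (N : ℕ) (z : Phase N) (x₀ : T3) : V3 :=
  (((N : ℝ) + 1))⁻¹ • ∑ i : Fin (N + 1), bump r (z i).1 x₀ • (z i).2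

/-- Local kinetic energy of the `r`-pool at `x₀`: `(N+1)⁻¹ Σ_i b_r(x_i, x₀) |v_i|²/2`. [folklore] -/
def poolEnergy (r : ℝ) (N : ℕ) (z : Phase N) (x₀ : T3) : ℝ :=
  (((N : ℝ) + 1))⁻¹ * ∑ i : Fin (N + 1), bump r (z i).1 x₀ * (‖(z i).2‖ ^ 2 / 2)

/-- Bulk velocity of the `r`-pool, `u = m/ρ` (junk `0` when the pool is empty). [folklore] -/
def poolVelocity (r : ℝ) (N : ℕ) (z : Phase N) (x₀ : T3) : V3 :=
  (poolMass r N z x₀)⁻¹ • poolMomentum r N z x₀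

/-- Temperature of the `r`-pool, `θ = (2/3)(e/ρ − |u|²/2)` (junk when the pool is empty or cold). [folklore] -/
def poolTemperature (r : ℝ) (N : ℕ) (z : Phase N) (x₀ : T3) : ℝ :=
  2 / 3 * (poolEnergy r N z x₀ / poolMass r N z x₀ - ‖poolVelocity r N z x₀‖ ^ 2 / 2)

/-- The `r`-pool tested against a velocity observable `F`: `(N+1)⁻¹ Σ_i b_r(x_i, x₀) F(v_i)`. [folklore] -/
def poolTest (F : V3 → ℝ) (r : ℝ) (N : ℕ) (z : Phase N) (x₀ : T3) : ℝ :=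
  (((N : ℝ) + 1))⁻¹ * ∑ i : Fin (N + 1), bump r (z i).1 x₀ * F (z i).2

/-- The local-Maxwellian defect of the `r`-pool, time–space integrated against `χ`:
`∫_{[0,τ]} ∫_{x₀} χ · (pool[F] − ρ ∫ F(v) M_{1,u,θ}(v) dv)(Φ_s z, x₀)` with `(ρ, u, θ)` the pool's own moments. [folklore] -/
def maxwellDefect (F : V3 → ℝ) (σ τ r : ℝ) (N : ℕ) (Φ : Flow σ N) (χ : ℝ × T3 → ℝ) (z : Phase N) : ℝ :=
  ∫ s in Icc (0 : ℝ) τ, ∫ x₀ : T3, χ (s, x₀) *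
    (poolTest F r N (Φ.flow s z) x₀ -
      poolMass r N (Φ.flow s z) x₀ *
        ∫ v : V3, F v * localMaxwellian 1 (poolTemperature r N (Φ.flow s z) x₀) (poolVelocity r N (Φ.flow s z) x₀) v)

/-! ## §3 Kinetic units

The two scalings of the frame read in mean free paths (used by the kinetic-cell lines on `PercolationClosesChaos`:
cells of radius `c ℓ_N`, windows of `M h ℓ_N`): the diameter is a FIXED multiple `π σ³` of the mean free path, and the
unit torus measures `ℓ_N⁻¹ = π σ² (N+1)^{1/3} → ∞` mean free paths (so the torus gas seen at the kinetic scale is an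
infinite-volume limit). Companion of `succ_mul_hsDiameter_pow_three` (`(N+1) ε_N³ = σ³`). -/

/-- KINETIC UNITS, diameter over mean free path: `ε_N / ℓ_N = π (N+1) ε_N³ = π σ³` for every `N` and every real `σ` (no
positivity needed: `a / b⁻¹ = a * b` also at `b = 0`). [folklore] -/
theorem hsDiameter_div_meanFreePath (σ : ℝ) (N : ℕ) :
    hsDiameter σ N / meanFreePath σ N = Real.pi * σ ^ 3 := by
  rw [meanFreePath, div_inv_eq_mul, ← succ_mul_hsDiameter_pow_three σ N]
  push_cast
  ring

/-- KINETIC UNITS, the mean free path in closed form: `ℓ_N⁻¹ = π (N+1) ε_N² = π σ² (N+1)^{1/3}`. [folklore] -/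
theorem inv_meanFreePath_eq (σ : ℝ) (N : ℕ) :
    (meanFreePath σ N)⁻¹ = Real.pi * σ ^ 2 * ((N + 1 : ℕ) : ℝ) ^ (1 / 3 : ℝ) := by
  have hN : (0 : ℝ) < ((N + 1 : ℕ) : ℝ) := by positivity
  have h13 : ((N + 1 : ℕ) : ℝ) * (((N + 1 : ℕ) : ℝ) ^ (-(1 / 3 : ℝ))) ^ 2 = ((N + 1 : ℕ) : ℝ) ^ (1 / 3 : ℝ) := by
    rw [← Real.rpow_natCast (((N + 1 : ℕ) : ℝ) ^ (-(1 / 3 : ℝ))) 2, ← Real.rpow_mul hN.le]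
    conv_lhs => rw [← Real.rpow_one ((N + 1 : ℕ) : ℝ), ← Real.rpow_mul hN.le, ← Real.rpow_add hN]
    norm_num
  rw [meanFreePath, inv_inv, hsDiameter, mul_pow]
  push_cast at h13 ⊢
  rw [show Real.pi * ((N : ℝ) + 1) * (σ ^ 2 * (((N : ℝ) + 1) ^ (-(1 / 3 : ℝ))) ^ 2) =
    Real.pi * σ ^ 2 * (((N : ℝ) + 1) * (((N : ℝ) + 1) ^ (-(1 / 3 : ℝ))) ^ 2) by ring, h13]

/-- KINETIC UNITS, the torus side in mean free paths diverges: `ℓ_N⁻¹ → ∞` as `N → ∞` for `σ > 0` (the kinetic blow-up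
of the unit torus exhausts `ℝ³`). [folklore] -/
theorem tendsto_inv_meanFreePath_atTop {σ : ℝ} (hσ : 0 < σ) :
    Filter.Tendsto (fun N : ℕ => (meanFreePath σ N)⁻¹) Filter.atTop Filter.atTop := by
  simp_rw [inv_meanFreePath_eq]
  have h1 : Filter.Tendsto (fun N : ℕ => ((N + 1 : ℕ) : ℝ)) Filter.atTop Filter.atTop :=
    tendsto_natCast_atTop_atTop.comp (Filter.tendsto_add_atTop_nat 1)
  exact ((tendsto_rpow_atTop (by norm_num : (0 : ℝ) < 1 / 3)).comp h1).const_mul_atTop (by positivity)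

/-- KINETIC UNITS, the mean free path is positive for `σ > 0`. [folklore] -/
theorem meanFreePath_pos {σ : ℝ} (hσ : 0 < σ) (N : ℕ) : 0 < meanFreePath σ N := by
  unfold meanFreePath
  have := hsDiameter_pos hσ N
  positivity

/-- KINETIC UNITS, the mean free path tends to `0` (`ℓ_N = (π σ²)⁻¹ (N+1)^{-1/3}`), for `σ > 0`. [folklore] -/
theorem tendsto_meanFreePath {σ : ℝ} (hσ : 0 < σ) :
    Filter.Tendsto (fun N : ℕ => meanFreePath σ N) Filter.atTop (nhds 0) := by
  have h := (tendsto_inv_meanFreePath_atTop hσ).inv_tendsto_atTop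
  refine h.congr fun N => ?_
  simp only [Pi.inv_apply, inv_inv]

end VelocityBlindPlacement

end Literature.MathematicalPhysics.KineticTheory

end
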